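import Summits.HodgeConjecture.HodgeConjecture.Theorems.R90S4WeylCountFiner          -- ★ p864120 (this seat): `IsFinerCount`, `IsFinerCount.tCount`, `.wF_pos`
import Summits.HodgeConjecture.HodgeConjecture.Theorems.R90S4EpsTubeReachability       -- ★ p864168 (this seat): brings ★ TUBE-EQ (`eq_of_isConj_of_mem_cartan`), ★ TrivialTypes (`mk_mem_stableIndexSet`), ★ dict
import Summits.HodgeConjecture.HodgeConjecture.Theorems.R90S4EpsWeylFinite             -- ★ p864025 (R90-C131-p05, WEYL-ε): the ε-normaliser membership predicate (HEADS v2 §A6′), `index_centralizer_subgroupOf_epsNormalizer_ne_zero`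
import HarnessLib

/-!
# R90-TF · S4 «Ch. 13.1–2», T-WIF road, letter (WEYL-COUNT-T) AS A NAMED PREDICATE, DICT-FREE, and its derivation from the FINER COUNT
# (Rogawski 1990, §12.5 pp. 182, 186: the constants `|Ω_F(T,G)|⁻¹` of the twisted Weyl integration formula regrouped over the stable class of `T`)

Cell `hodgecm-mathlib`, crux H413 (`stmt-HodgeConjecture-24833`, lane `--supports … --as helper`), route of record `HCCMUnconditional` (no route verbs;
count-neutral).  Programme R90-TF, section S4, dealer K2E2-plan (g7): RULING S4-R33 (c) 2026-09-05T01:39:41Z «(WEYL-COUNT-T) BYTES = p12's PEN: ONE small ★ file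
`Theorems/R90S4WeylCountTLetter.lean` = `def IsTwistedWeylCountT …` in p03's DICT-FREE `∼st` form + the BRIDGE `isTwistedWeylCountT_of_isFinerCount`»; seat K2E3-p12 (g10).
Consumer: R90-C131-p03 (g3)'s (B1-Σ) assembly of the ε-twisted Weyl integration formula `IsTwistedWeylMeasure … (stableCartanMeasure L v C tT n) sec₀` (CENSUS-B1-assembly.md §3),
which binds `(hwc : IsTwistedWeylCountT L v C n)` hypothesis-first and unfolds it.

THE LETTER (§1), for the Cartan system `C` of `G_v = U(Φ₃)(L⁺_v)` and the class count `n`: for every member `T_k`, every regular `t_k ∈ T_k` (so `T̃_k := Cent_{G̃_v}(t_k)`),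
every subgroup `Ñ` with the ε-NORMALISER membership predicate of ★ `R90S4EpsWeylFinite` («`m ∈ N_{G̃_v}(T̃_k) ∧ m ε(m)⁻¹ ∈ T̃_k`», HEADS v2 §A6′ verbatim), and every choice of
regular points `t_i ∈ T_i`:  `[Ñ : T̃_k]⁻¹ = Σ_{i : T_i ∼_{st} T_k} ([N(T_i):T_i] · n(t_i))⁻¹`, where `T_i ∼_{st} T_k :⟺ ∃ s ∈ T_i^{reg}, ∃ s′ ∈ T_k, s ∼_{st} s′` — print's
`|Ω_F(T,G)|⁻¹` (p. 186) against the weights `([N(T″):T″] · n)⁻¹` of ★ `stableCartanMeasure` summed over the stable class.  NO dictionary datum appears (the dict's `m, τ` are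
∃-bound); `n` is read at arbitrary regular points (constant there by the dict's clause (N)).

THE BRIDGE (§2): from the VISIBLE per-member data `(μ, N, wF)` of ★ `isStableTransportDict_of_forall_member` (its `hmem` row, clause (N) as `hN`), the FINER COUNT
★ `IsFinerCount μ N (fun i => [N(T_i):T_i]) wF` and the VALUE of the ε-Weyl index `hwF : [Ñ : T̃_k] = wF k` (the one per-type input this letter exposes), the letter HOLDS:
★ `IsFinerCount.tCount` gives `wF k · Σ_{i : N k i ≠ 0} ([N(T_i):T_i] · μ i)⁻¹ = 1`, and the index sets agree — `N k i ≠ 0 ⟺ T_i ∼_{st} T_k` (package level: (⇒) the transport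
`e_k j : T_k ≃ₜ* T_i`; (⇐) member `i`'s clause (B) + ★ `eq_of_isConj_of_mem_cartan` give `N i k ≠ 0`, then (F3)).

HONEST LABEL: HC_CM is proved only modulo the 7 printed citations (2 remaining named inputs: hLiu418 = stmt-HodgeConjecture-24832, h413 = stmt-HodgeConjecture-24833) until rung 0
closes.  A letter and its converter; the FINER COUNT and `hwF` are paid per Cartan type by the (DICT) hands; (B1) and (W-NP) stay OPEN.  REL ≠ ★ ≠ BUILT.
One definition (review lane, D-0009), one theorem; no instance, no notation, no `sorry`.

## References
* [Rogawski1990] J. D. Rogawski, *Automorphic Representations of Unitary Groups in Three Variables*, Ann. of Math. Stud. 123 (1990), §12.5 pp. 182, 186; §3.6 pp. 28–31; §3.5 p. 28.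
-/

set_option autoImplicit false
set_option linter.dupNamespace false

noncomputable section

open MeasureTheory Measure Set Filter Topology Function NumberField IsDedekindDomain
open Literature.MeasureTheory.Group
open Literature.NumberTheory.Automorphic Literature.NumberTheory.Automorphic.UnitaryGroup Literature.NumberTheory.Rogawski1990
open Literature.NumberTheory.Rogawski1990.Ch4Sec10
open Summit.HodgeConjecture.HodgeConjecture.Cruxes.H413
open scoped ENNReal NNReal MatrixGroups Pointwise

namespace Summit.HodgeConjecture.HodgeConjecture.R90.S4

section WeylCountTLetter

variable (L : Type) [Field L] [NumberField L] [IsCMField L] (v : HeightOneSpectrum (𝓞 ↥(maximalRealSubfield L)))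

/-! ## §1 The letter -/

open scoped Classical in
/-- **(WEYL-COUNT-T), the T-side Weyl count of the twisted Weyl integration formula, as a DICT-FREE predicate on `(C, n)`**: for every member `T_k`, every regular
`t_k ∈ T_k`, every subgroup `Ñ` with the ε-normaliser membership predicate at `T̃_k = Cent_{G̃_v}(t_k)` (★ `R90S4EpsWeylFinite`, HEADS v2 §A6′), and every family of regular points
`t_i ∈ T_i`: `[Ñ : T̃_k]⁻¹ = Σ_{i : T_i ∼_{st} T_k} ([N(T_i):T_i] · n(t_i))⁻¹` (`T_i ∼_{st} T_k :⟺ ∃ s ∈ T_i^{reg}, ∃ s′ ∈ T_k, s ∼_{st} s′`).  Print: the constant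
`|Ω_F(T,G)|⁻¹` of p. 186 against the weights of p. 182's second display summed over the stable class of `T`. [cite: Rogawski1990, §12.5 pp. 182, 186] -/
def IsTwistedWeylCountT (C : Finset (Subgroup (Gqs L v))) (n : Gqs L v → ℕ) : Prop :=
  ∀ (k : ↥C) (tk : ↥(k : Subgroup (Gqs L v))), IsRegularElt (((tk : Gqs L v)).val : GL (Fin 3) (LocalRing L v)) →
    ∀ N' : Subgroup (GtLoc L v),
      (∀ m : GtLoc L v, m ∈ N' ↔
        m ∈ Subgroup.normalizer ((Subgroup.centralizer ({((tk : Gqs L v).val : GtLoc L v)} : Set (GtLoc L v)) : Subgroup (GtLoc L v)) : Set (GtLoc L v)) ∧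
          m * (epsLoc L (R90.S4.splitFormGL L) v m)⁻¹ ∈ Subgroup.centralizer ({((tk : Gqs L v).val : GtLoc L v)} : Set (GtLoc L v))) →
      ∀ t : ∀ i : ↥C, ↥(i : Subgroup (Gqs L v)), (∀ i : ↥C, IsRegularElt (((t i : Gqs L v)).val : GL (Fin 3) (LocalRing L v))) →
        ((((Subgroup.centralizer ({((tk : Gqs L v).val : GtLoc L v)} : Set (GtLoc L v))).subgroupOf N').index : ℝ))⁻¹ =
          ∑ i ∈ Finset.univ.filter (fun i : ↥C => ∃ s : ↥(i : Subgroup (Gqs L v)), IsRegularElt (((s : Gqs L v)).val : GL (Fin 3) (LocalRing L v)) ∧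
              ∃ s' : ↥(k : Subgroup (Gqs L v)), IsStablyConjGAt L (R90.S4.splitFormGL L) v (s : Gqs L v) (s' : Gqs L v)),
            ((((i : Subgroup (Gqs L v)).subgroupOf (Subgroup.normalizer ((i : Subgroup (Gqs L v)) : Set (Gqs L v)))).index : ℝ) * (n (t i : Gqs L v) : ℝ))⁻¹

/-! ## §2 The bridge from the finer count -/

/-- **(WEYL-COUNT-T) FROM THE FINER COUNT.**  Given the per-member packages of ★ `isStableTransportDict_of_forall_member` (visible class counts `μ`, fibre counts `N`, its `hmem`
row and clause (N) `hN`), the `hZ`, `hirr` letters of ★ CARTAN-ALL, the finer count ★ `IsFinerCount μ N (fun i => [N(T_i):T_i]) wF`, and the VALUE of the ε-Weyl index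
`hwF : [Ñ : T̃_k] = wF k` (for every regular `t_k ∈ T_k` and every `Ñ` with the ε-normaliser predicate), the letter `IsTwistedWeylCountT L v C n` holds: ★ `IsFinerCount.tCount`
+ «`N k i ≠ 0 ⟺ T_i ∼_{st} T_k`» (package level) + `hN` on the summands. [cite: Rogawski1990, §12.5 pp. 182, 186; §3.6 pp. 28–31] -/
theorem isTwistedWeylCountT_of_isFinerCount {C : Finset (Subgroup (Gqs L v))} {n : Gqs L v → ℕ}
    (hZ : ∀ T ∈ C, ∃ γ₀ : Gqs L v, IsRegularElt (γ₀.val : GL (Fin 3) (LocalRing L v)) ∧ T = Subgroup.centralizer ({γ₀} : Set (Gqs L v)))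
    (hirr : ∀ T ∈ C, ∀ T' ∈ C, T ≠ T' → ∀ y : Gqs L v, ¬ ∀ h : Gqs L v, h ∈ T' ↔ y⁻¹ * h * y ∈ T)
    (μ : ↥C → ℕ) (N : ↥C → ↥C → ℕ) (wF : ↥C → ℕ)
    (hmem : ∀ i : ↥C, ∃ (k : ℕ) (τ : Fin k → ↥C) (e : ∀ j : Fin k, ↥(i : Subgroup (Gqs L v)) ≃ₜ* ↥((τ j : ↥C) : Subgroup (Gqs L v))),
      k = μ i ∧ (∀ k' : ↥C, Nat.card {j : Fin k // τ j = k'} = N i k') ∧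
      (∀ (j : Fin k) (t : ↥(i : Subgroup (Gqs L v))),
          IsStablyConjGAt L (R90.S4.splitFormGL L) v (t : Gqs L v) ((e j t : ↥((τ j : ↥C) : Subgroup (Gqs L v))) : Gqs L v)) ∧
      (∀ (j : Fin k) (t : ↥(i : Subgroup (Gqs L v))), IsRegularElt (((t : Gqs L v)).val : GL (Fin 3) (LocalRing L v)) →
          cartanWeight L v ((τ j : ↥C) : Subgroup (Gqs L v)) (e j t) = cartanWeight L v (i : Subgroup (Gqs L v)) t) ∧
      (∀ t : ↥(i : Subgroup (Gqs L v)), IsRegularElt (((t : Gqs L v)).val : GL (Fin 3) (LocalRing L v)) →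
          Set.BijOn (fun j : Fin k => ConjClasses.mk ((e j t : ↥((τ j : ↥C) : Subgroup (Gqs L v))) : Gqs L v)) Set.univ
            {c : ConjClasses (Gqs L v) | IsStablyConjGAt L (R90.S4.splitFormGL L) v (t : Gqs L v) (Quotient.out c)}))
    (hN : ∀ (i : ↥C) (t : ↥(i : Subgroup (Gqs L v))), IsRegularElt (((t : Gqs L v)).val : GL (Fin 3) (LocalRing L v)) → n (t : Gqs L v) = μ i)
    (hF : IsFinerCount μ N
      (fun i : ↥C => ((i : Subgroup (Gqs L v)).subgroupOf (Subgroup.normalizer ((i : Subgroup (Gqs L v)) : Set (Gqs L v)))).index) wF)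
    (hwF : ∀ (k : ↥C) (tk : ↥(k : Subgroup (Gqs L v))), IsRegularElt (((tk : Gqs L v)).val : GL (Fin 3) (LocalRing L v)) →
      ∀ N' : Subgroup (GtLoc L v),
        (∀ m : GtLoc L v, m ∈ N' ↔
          m ∈ Subgroup.normalizer ((Subgroup.centralizer ({((tk : Gqs L v).val : GtLoc L v)} : Set (GtLoc L v)) : Subgroup (GtLoc L v)) : Set (GtLoc L v)) ∧
            m * (epsLoc L (R90.S4.splitFormGL L) v m)⁻¹ ∈ Subgroup.centralizer ({((tk : Gqs L v).val : GtLoc L v)} : Set (GtLoc L v))) →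
        ((Subgroup.centralizer ({((tk : Gqs L v).val : GtLoc L v)} : Set (GtLoc L v))).subgroupOf N').index = wF k) :
    IsTwistedWeylCountT L v C n := by
  classical
  intro k tk htk N' hN' t ht
  rw [hwF k tk htk N' hN']
  have hwFk : (wF k : ℝ) ≠ 0 := Nat.cast_ne_zero.mpr (hF.wF_pos k).ne'
  -- the index sets agree: `N k i ≠ 0 ⟺ T_i ∼_{st} T_k`
  have hset : Finset.univ.filter (fun i : ↥C => N k i ≠ 0) =
      Finset.univ.filter (fun i : ↥C => ∃ s : ↥(i : Subgroup (Gqs L v)), IsRegularElt (((s : Gqs L v)).val : GL (Fin 3) (LocalRing L v)) ∧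
        ∃ s' : ↥(k : Subgroup (Gqs L v)), IsStablyConjGAt L (R90.S4.splitFormGL L) v (s : Gqs L v) (s' : Gqs L v)) := by
    refine Finset.filter_congr fun i _ => ⟨fun hki => ?_, fun hst => ?_⟩
    · -- a transport `e_k j : T_k ≃ₜ* T_i` moves `tk` to a regular, stably conjugate point of `T_i`
      obtain ⟨m, τ, e, -, hcard, hS, -, -⟩ := hmem k
      have hex : ∃ j : Fin m, τ j = i := by
        rw [← hcard i, ← Nat.pos_iff_ne_zero, Finite.card_pos_iff, nonempty_subtype] at hki
        exact hki
      obtain ⟨j, rfl⟩ := hex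
      exact ⟨e j tk, isRegularElt_of_isConj (hS j tk) htk, tk, IsConj.symm (hS j tk)⟩
    · -- member `i`'s clause (B) lists `⟦s′⟧`; ★ `eq_of_isConj_of_mem_cartan` pins the target; (F3) flips the pair
      obtain ⟨s, hs, s', hss'⟩ := hst
      obtain ⟨m, τ, e, -, hcard, hS, -, hB⟩ := hmem i
      have hcls : ConjClasses.mk (s' : Gqs L v) ∈
          {c : ConjClasses (Gqs L v) | IsStablyConjGAt L (R90.S4.splitFormGL L) v (s : Gqs L v) (Quotient.out c)} :=
        IsConj.trans hss' (mk_mem_stableIndexSet (s' : Gqs L v))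
      obtain ⟨j, -, hj⟩ := (hB s hs).surjOn hcls
      have hconj : IsConj ((e j s : ↥((τ j : ↥C) : Subgroup (Gqs L v))) : Gqs L v) (s' : Gqs L v) := ConjClasses.mk_eq_mk_iff_isConj.mp hj
      have hreg : IsRegularElt ((((e j s : ↥((τ j : ↥C) : Subgroup (Gqs L v))) : Gqs L v)).val : GL (Fin 3) (LocalRing L v)) :=
        isRegularElt_of_isConj (hS j s) hs
      have hτ : τ j = k := eq_of_isConj_of_mem_cartan hZ hirr (e j s) hreg s' hconj
      have hik : N i k ≠ 0 := by
        rw [← hcard k, ← Nat.pos_iff_ne_zero, Finite.card_pos_iff, nonempty_subtype]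
        exact ⟨j, hτ⟩
      exact hF.2.2.1 i k hik
  -- the summands agree on regular points: `n(t_i) = μ i`
  rw [← hset, Finset.sum_congr rfl fun i _ => by rw [hN i (t i) (ht i)]]
  -- ★ `tCount`: `wF k · Σ = 1`
  exact (eq_inv_of_mul_eq_one_right (hF.tCount k)).symm ▸ rfl

end WeylCountTLetter

end Summit.HodgeConjecture.HodgeConjecture.R90.S4

end
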